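import Mathlib
import Summits.AtomisticToContinuum.HydrodynamicLimit.Theorems.InformationPercolationEngineKickFairRelEquilibriumMesoTransferSlots
import Summits.AtomisticToContinuum.HydrodynamicLimit.Theorems.InformationPercolationEngineKickFairRelEquilibriumMesoTransferEnum
import Summits.AtomisticToContinuum.HydrodynamicLimit.Theorems.JParityClosureEvenStressEnskogShortFlightDeficitRung0
import Literature.MathematicalPhysics.KineticTheory.CollisionFluxMeanBound
import Literature.Analysis.FluidPDE.EmpiricalCollisionMeasureMeasurable
import HarnessLib

/-!
# `KickFairRelEquilibriumMeso`, line `Sketch` — stub U at rung 0, part B: pathwise domination of the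
# line's short-flight functional by the short-flight count, and the measurable charged terms

Helper file (`--supports stmt-AtomisticToContinuum-15177`) of the line lead for the registered stub
`stub_shortFlightLG`, rung-0 case (constant profiles). Two inputs of the first-moment computation:

* `sum_shortFlag_le_collisionPairSum` (STEP 1, pathwise, good orbit, `ε < 1/2`): the line's functional
  `Σ_i #{n < cnt_i(τ) : t_{i,n} − flightStart(0, i, t_{i,n}) < Δ}` (collisions of `i` in `(0, τ]` preceded by a
  flight of `i` shorter than `Δ`) is at most the SHORT-FLIGHT COUNT of `ShortFlightCharging`,
  `Σ_{collisions (s,i,j), s ∈ [0,τ]} 𝟙{s − Δ < pairFlightStart(i,j,s)}`: for `n < cnt_i` the enumerated time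
  `t_{i,n}` is a collision time of `i` in `(0, τ]` and `n ↦ t_{i,n}` is injective
  (`nthTimeAfter_mem_of_lt_ncard`, `strictMonoOn_nthTimeAfter_of_ncard`), `(i, partner)` is an ordered contact
  pair there (`collide_partner`, regular geometry), and `pairFlightStart ≥ flightStart` of `i`;
* `ofReal_collisionPairSum_eq`, `collisionSum_relSpeed_eq`, `past_time_eq` — bookkeeping: `ENNReal.ofReal` of a
  nonnegative collision pair sum is the inline `ℝ≥0∞` collision sum of the mean collision-flux engine
  (`CollisionFluxMeanBound`); the charged term `K₃ = Σ_{collisions} ‖vⱼ − vᵢ‖/R` is the flow's collision sum of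
  a continuous function of the collision MARK (the elastic reflection preserves `‖vⱼ − vᵢ‖`), hence
  measurable in the datum once cut to the good set (`HardSphereFlow.measurable_indicator_collisionSum_Icc`);
  on the good set the typed past carries the genuine times.

References: C. Cercignani, R. Illner, M. Pulvirenti, *The Mathematical Theory of Dilute Gases* (1994),
App. 4.A; I. Gallagher, L. Saint-Raymond, B. Texier, *From Newton to Boltzmann* (2013), Prop. 4.1.1.
-/

noncomputable section

open MeasureTheory Set Filter Topology
open scoped ENNReal InnerProductSpace BigOperators Classical

namespace Summit.AtomisticToContinuum.HydrodynamicLimit.Theorems.KickFairRelEquilibriumMesoLine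

open Literature.Analysis.FluidPDE Literature.Analysis.FunctionSpaces Literature.MathematicalPhysics.KineticTheory

variable {σ : ℝ} {N : ℕ} {Φ : Flow σ N} {z : Phase N}

/-- On the good set the typed past carries the genuine times: `.2.2.2 = t_{i,n}` and `.2.1` is the start of
the free flight of `i` ending at `t_{i,n}`. [folklore] -/
theorem past_time_eq (hz : z ∈ Φ.good) (r : ℝ) (i : Fin (N + 1)) (n : ℕ) :
    (past Φ r z i n).2.2.2 = Φ.nthCollisionTimeOf i n z ∧
      (past Φ r z i n).2.1 = flightStart (Torus.geometry (Fin 3)) (hsDiameter σ N) (orbit σ N Φ z) 0 i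
        (Φ.nthCollisionTimeOf i n z) := by
  unfold past
  rw [if_pos hz]
  exact ⟨rfl, rfl⟩

/-- **Step 1 (pathwise domination).** Along a good orbit (`ε < 1/2`), for every horizon `τ` and threshold
`Δ`, the number of pairs `(i, n)`, `n < cnt_i(τ)`, whose collision time `t_{i,n}` is preceded by a flight of
`i` shorter than `Δ` is at most the short-flight count
`Σ_{collisions (s,i,j), s ∈ [0,τ]} 𝟙{s − Δ < pairFlightStart(i,j,s)}` of `ShortFlightCharging`. [folklore] -/
theorem sum_shortFlag_le_collisionPairSum (hz : z ∈ Φ.good) (hε2 : hsDiameter σ N < 1 / 2) (τ Δ : ℝ) :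
    (∑ i : Fin (N + 1), ∑ n ∈ Finset.range (cnt Φ τ z i),
        (if Φ.nthCollisionTimeOf i n z - flightStart (Torus.geometry (Fin 3)) (hsDiameter σ N) (orbit σ N Φ z) 0 i
            (Φ.nthCollisionTimeOf i n z) < Δ then (1 : ℝ) else 0)) ≤
      collisionPairSum (Torus.geometry (Fin 3)) (hsDiameter σ N) (orbit σ N Φ z) (Icc 0 τ)
        (fun s i j => if s - Δ < pairFlightStart σ N Φ z i j s then (1 : ℝ) else 0) := by
  classical
  have hγ := isTraj hz
  have hG : (Torus.geometry (Fin 3)).IsHardSphereRegular (hsDiameter σ N) :=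
    Torus.isHardSphereRegular_geometry (by rw [← one_div]; exact hε2)
  have hfin := hγ.locFinite 0 τ
  have hTf := finite_collisionTriples hfin
  rw [collisionPairSum_eq_finsum_triples hfin, finsum_mem_eq_finite_toFinset_sum _ hTf]
  set T := hTf.toFinset with hTdef
  set g : ℝ × Fin (N + 1) × Fin (N + 1) → ℝ := fun e =>
    if e.1 - Δ < pairFlightStart σ N Φ z e.2.1 e.2.2 e.1 then (1 : ℝ) else 0 with hgdef
  set tm : Fin (N + 1) → ℕ → ℝ := fun i n => Φ.nthCollisionTimeOf i n z with htmdef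
  set Θ : (Σ _ : Fin (N + 1), ℕ) → ℝ × Fin (N + 1) × Fin (N + 1) := fun q =>
    (tm q.1 q.2, q.1, partner (Torus.geometry (Fin 3)) (hsDiameter σ N) (orbit σ N Φ z (tm q.1 q.2)) q.1)
    with hΘdef
  set D : Finset (Σ _ : Fin (N + 1), ℕ) := Finset.univ.sigma fun i => Finset.range (cnt Φ τ z i) with hDdef
  have hg0 : ∀ e, 0 ≤ g e := fun e => by
    simp only [hgdef]
    split_ifs <;> norm_num
  -- enumerated times are collision times of `i` in `(0, τ]`
  have hmem : ∀ i : Fin (N + 1), ∀ n, n < cnt Φ τ z i →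
      tm i n ∈ collisionTimesOf (Torus.geometry (Fin 3)) (hsDiameter σ N) (orbit σ N Φ z) i ∩ Ioc 0 τ :=
    fun i n hn => nthTimeAfter_mem_of_lt_ncard hn
  -- the ordered contact pair `(i, partner)` at such a time
  have hcp : ∀ i : Fin (N + 1), ∀ n, n < cnt Φ τ z i →
      (i, partner (Torus.geometry (Fin 3)) (hsDiameter σ N) (orbit σ N Φ z (tm i n)) i) ∈
        contactPairs (Torus.geometry (Fin 3)) (hsDiameter σ N) (orbit σ N Φ z (tm i n)) := by
    intro i n hn
    rcases collide_partner (hmem i n hn).1 with h | h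
    · exact h
    · exact (swap_mem_contactPairs_iff hG).1 h
  have hΘT : ∀ q ∈ D, Θ q ∈ T := by
    rintro ⟨i, n⟩ hq
    have hn : n < cnt Φ τ z i := Finset.mem_range.1 (Finset.mem_sigma.1 hq).2
    exact hTf.mem_toFinset.2 (mem_collisionTriples.2 ⟨⟨(hmem i n hn).2.1.le, (hmem i n hn).2.2⟩, hcp i n hn⟩)
  have hinj : Set.InjOn Θ ↑D := by
    rintro ⟨i, n⟩ hq ⟨i', n'⟩ hq' heq
    have hi : i = i' := congrArg (fun e : ℝ × Fin (N + 1) × Fin (N + 1) => e.2.1) heq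
    subst hi
    have hn : n < cnt Φ τ z i := Finset.mem_range.1 (Finset.mem_sigma.1 (Finset.mem_coe.1 hq)).2
    have hn' : n' < cnt Φ τ z i := Finset.mem_range.1 (Finset.mem_sigma.1 (Finset.mem_coe.1 hq')).2
    have ht : tm i n = tm i n' := congrArg Prod.fst heq
    have hnn : n = n' := (strictMonoOn_nthTimeAfter_of_ncard (S := collisionTimesOf (Torus.geometry (Fin 3))
      (hsDiameter σ N) (orbit σ N Φ z) i) (a := 0) (b := τ)).injOn hn hn' ht
    subst hnn
    rfl
  have hpt : ∀ q ∈ D, (if tm q.1 q.2 - flightStart (Torus.geometry (Fin 3)) (hsDiameter σ N) (orbit σ N Φ z) 0 q.1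
      (tm q.1 q.2) < Δ then (1 : ℝ) else 0) ≤ g (Θ q) := by
    intro q _
    by_cases h : tm q.1 q.2 - flightStart (Torus.geometry (Fin 3)) (hsDiameter σ N) (orbit σ N Φ z) 0 q.1
        (tm q.1 q.2) < Δ
    · rw [if_pos h]
      have h' : tm q.1 q.2 - Δ < pairFlightStart σ N Φ z q.1
          (partner (Torus.geometry (Fin 3)) (hsDiameter σ N) (orbit σ N Φ z (tm q.1 q.2)) q.1) (tm q.1 q.2) := by
        unfold pairFlightStart
        exact lt_of_lt_of_le (by linarith) (le_max_left _ _)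
      have : g (Θ q) = 1 := by
        simp only [hgdef, hΘdef]
        rw [if_pos h']
      rw [this]
    · rw [if_neg h]
      exact hg0 _
  calc ∑ i : Fin (N + 1), ∑ n ∈ Finset.range (cnt Φ τ z i),
        (if Φ.nthCollisionTimeOf i n z - flightStart (Torus.geometry (Fin 3)) (hsDiameter σ N) (orbit σ N Φ z) 0 i
            (Φ.nthCollisionTimeOf i n z) < Δ then (1 : ℝ) else 0)
      = ∑ q ∈ D, (if tm q.1 q.2 - flightStart (Torus.geometry (Fin 3)) (hsDiameter σ N) (orbit σ N Φ z) 0 q.1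
          (tm q.1 q.2) < Δ then (1 : ℝ) else 0) := by
        rw [hDdef, Finset.sum_sigma]
    _ ≤ ∑ q ∈ D, g (Θ q) := Finset.sum_le_sum hpt
    _ = ∑ e ∈ D.image Θ, g e := (Finset.sum_image hinj).symm
    _ ≤ ∑ e ∈ T, g e :=
        Finset.sum_le_sum_of_subset_of_nonneg (Finset.image_subset_iff.2 hΘT) fun e _ _ => hg0 e

/-- **`ENNReal.ofReal` through a nonnegative collision pair sum** (good orbit, finitely many collision
times in the window): the result is the inline `ℝ≥0∞` collision sum of the mean collision-flux engine
(along `orbit σ N Φ z = fun s => Φ.flow s z`), with any `ℝ≥0∞` marks `g'` agreeing with `ENNReal.ofReal ∘ g`.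
[folklore] -/
theorem ofReal_collisionPairSum_eq (hz : z ∈ Φ.good) {S : Set ℝ}
    (hfin : (collisionTimes (Torus.geometry (Fin 3)) (hsDiameter σ N) (orbit σ N Φ z) ∩ S).Finite)
    {g : ℝ → Fin (N + 1) → Fin (N + 1) → ℝ} {g' : ℝ → Fin (N + 1) → Fin (N + 1) → ℝ≥0∞}
    (hg : ∀ s i j, 0 ≤ g s i j) (hgg' : ∀ s i j, ENNReal.ofReal (g s i j) = g' s i j) :
    ENNReal.ofReal (collisionPairSum (Torus.geometry (Fin 3)) (hsDiameter σ N) (orbit σ N Φ z) S g) =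
      ∑ᶠ s ∈ collisionTimes (Torus.geometry (Fin 3)) (hsDiameter σ N) (orbit σ N Φ z) ∩ S,
        ∑ i : Fin (N + 1), ∑ j : Fin (N + 1),
          (if i ≠ j ∧ ‖(Torus.geometry (Fin 3)).sepVec (orbit σ N Φ z s i).1 (orbit σ N Φ z s j).1‖ = hsDiameter σ N
            then g' s i j else 0) := by
  rw [collisionPairSum_eq_finsum_ite (orbit_mem hz)]
  have hnn : ∀ (s : ℝ) (i j : Fin (N + 1)), (0 : ℝ) ≤
      (if i ≠ j ∧ ‖(Torus.geometry (Fin 3)).sepVec (orbit σ N Φ z s i).1 (orbit σ N Φ z s j).1‖ = hsDiameter σ N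
        then g s i j else 0) := by
    intro s i j
    split_ifs
    · exact hg s i j
    · exact le_rfl
  rw [finsum_mem_eq_finite_toFinset_sum _ hfin, finsum_mem_eq_finite_toFinset_sum _ hfin,
    ENNReal.ofReal_sum_of_nonneg fun s _ => Finset.sum_nonneg fun i _ => Finset.sum_nonneg fun j _ => hnn s i j]
  refine Finset.sum_congr rfl fun s _ => ?_
  rw [ENNReal.ofReal_sum_of_nonneg fun i _ => Finset.sum_nonneg fun j _ => hnn s i j]
  refine Finset.sum_congr rfl fun i _ => ?_
  rw [ENNReal.ofReal_sum_of_nonneg fun j _ => hnn s i j]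
  refine Finset.sum_congr rfl fun j _ => ?_
  split_ifs
  · exact hgg' s i j
  · exact ENNReal.ofReal_zero

/-- **The charged term `K₃` is a collision sum of a continuous function of the mark.** For every datum,
window `[0, τ]` and `R`, the flow's collision sum of `‖v⁻_snd − v⁻_fst‖ / R` (pre-collisional velocities of the
mark) is `Σ_{collisions (s,i,j)} ‖vⱼ(s) − vᵢ(s)‖ / R` (the elastic reflection preserves the modulus of the relative
velocity, `norm_snd_sub_fst_reflectVel`). [folklore] -/
theorem collisionSum_relSpeed_eq (Φ : Flow σ N) (z : Phase N) (τ R : ℝ) :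
    Φ.collisionSum (Icc 0 τ) (fun c => (fun m : ℝ × T3 × V3 × V3 × V3 => ‖m.2.2.2.2 - m.2.2.2.1‖ / R) c.mark) z =
      collisionPairSum (Torus.geometry (Fin 3)) (hsDiameter σ N) (orbit σ N Φ z) (Icc 0 τ)
        (fun s i j => ‖(orbit σ N Φ z s j).2 - (orbit σ N Φ z s i).2‖ / R) := by
  rw [HardSphereFlow.collisionSum_eq, Literature.Analysis.FluidPDE.collisionSum_eq_collisionPairSum]
  simp only [orbit]
  congr 1
  funext s i j
  simp only [HardSphereCollisionRecord.mark_def, HardSphereCollisionRecord.ofConfig_preVel,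
    HardSphereCollisionRecord.ofConfig_time, HardSphereCollisionRecord.ofConfig_fstPos,
    HardSphereCollisionRecord.ofConfig_impactVec]
  rw [norm_snd_sub_fst_reflectVel]

/-- Measurability of the charged term `K₃` cut to the good set (`ε < 1/2`). [folklore] -/
theorem measurable_ofReal_indicator_relSpeedSum (Φ : Flow σ N) (hε2 : hsDiameter σ N < 1 / 2) (τ R : ℝ) :
    Measurable fun z : Phase N => ENNReal.ofReal (Φ.good.indicator (fun z =>
      Φ.collisionSum (Icc 0 τ) (fun c => (fun m : ℝ × T3 × V3 × V3 × V3 => ‖m.2.2.2.2 - m.2.2.2.1‖ / R) c.mark) z) z) := by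
  have hG : (Torus.geometry (Fin 3)).IsHardSphereRegular (hsDiameter σ N) :=
    Torus.isHardSphereRegular_geometry (by rw [← one_div]; exact hε2)
  exact (Φ.measurable_indicator_collisionSum_Icc hG Torus.isMeasurable_geometry
    (f := fun m : ℝ × T3 × V3 × V3 × V3 => ‖m.2.2.2.2 - m.2.2.2.1‖ / R) (by fun_prop) (by fun_prop) 0 τ).ennreal_ofReal

/-- Measurability of the charged term `K₁` (collisions before time `ℓ`, each in its two orders) cut to the good
set (`ε < 1/2`). [folklore] -/
theorem measurable_ofReal_indicator_countSum (Φ : Flow σ N) (hε2 : hsDiameter σ N < 1 / 2) (ℓ : ℝ) :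
    Measurable fun z : Phase N => ENNReal.ofReal (Φ.good.indicator (fun z =>
      Φ.collisionSum (Icc 0 ℓ) (fun _ => (1 : ℝ)) z) z) := by
  have hG : (Torus.geometry (Fin 3)).IsHardSphereRegular (hsDiameter σ N) :=
    Torus.isHardSphereRegular_geometry (by rw [← one_div]; exact hε2)
  exact (Φ.measurable_indicator_collisionSum_Icc hG Torus.isMeasurable_geometry
    (f := fun _ : ℝ × T3 × V3 × V3 × V3 => (1 : ℝ)) continuous_const measurable_const 0 ℓ).ennreal_ofReal

end Summit.AtomisticToContinuum.HydrodynamicLimit.Theorems.KickFairRelEquilibriumMesoLine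

end
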